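import Summits.BirchSwinnertonDyer.BirchSwinnertonDyer.Theorems.ByReductionTypeAtTwoSupersingularFlatCasselsCount
import Summits.BirchSwinnertonDyer.Rank1Residual.X2.GreenbergVatsalSelmerLink
import Literature.NumberTheory.EllipticCurves.Greenberg1999.NoProperFiniteIndexSubmoduleH1Sigma
import Literature.NumberTheory.EllipticCurves.LFunctionPrimeCoeff
import Literature.NumberTheory.EllipticCurves.IwasawaInvariantsFiniteOfRankOneProofs
import HarnessLib

/-!
# COUNT♭@2 FROM PRINT BY NAME: the count clause of `stub_allFlatData` from Greenberg's Prop. 4.13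
# (Cassels) and Prop. 4.12, both cited by name as Literature facts, plus the kernel of parts 1–8 — modulo
# exactly the local lifts at the finite places of `Σ` and the two displayed `Λ`-inputs of Prop. 4.12

Seat `bsd-2adic-ss-1` GEN 12, crux `SupersingularRankZeroAtTwo` (item stmt-BirchSwinnertonDyer-19097, route
`ByReductionTypeAtTwo`, rung K4), line `flat_uniform_two` v1, stub (2) `stub_allFlatData`, conjunct
COUNT♭@2 — part 9, the DOOR of the GEN 11–12 series (planner RC-176 (2) PATH: «when the KERNEL-ABLE-NOT-DONE
set lands as theorems … the tag collapses to PUB-COMPOSITE ∘ THEOREM»).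

THE DOOR `flatCountTwo_of_print`. For `W/ℚ` elliptic, globally minimal, good SUPERSINGULAR at `2`, the
cyclotomic `ℤ₂`-extension `κ` with topological generator `γ`, the place `v ∋ 2` with `♭`-data `(g, c)`
satisfying the two K3-shape clauses «`Ker Col♭` kills `E(ℚ₂)`» and «`r₂` injective» (both consequences of
the Honda₂ clauses of the line — GEN 10 `mem_localKerOver_of_flat_rat`), and `Σ₀ ⊇` the bad places, the
COUNT♭@2 clause `Finite Sel → Finite (Sel♭_∞)_γ → #ker g♭ · #E(ℚ)_2 = 2^{ord₂ ∏c} · #(Sel♭_∞)_γ` of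
`stub_allFlatData` follows from
* PRINT BY NAME: `Greenberg1999.casselsSurjectivity_H1Sigma ℚ` (LNM 1716 Prop. 4.13 / p. 122, Cassels' theorem)
  — used TWICE: for Cassels' count (part 8b) and for «LIFT» (part 7) — and
  `Greenberg1999.prop412_noFiniteSubmodule_H1Sigma_of_rank_one` (LNM 1716 Prop. 4.12: «`H¹(F_Σ/F_∞, E[p^∞])`
  has no proper `Λ`-submodule of finite index» under `Λ`-corank `1`);
* THEOREM: parts 1–8 (GEN 11–12) + the tree (`#E(ℚ)[2^∞] = 1` at a good supersingular `2`, `Sel_∞ ⊆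
  H¹(ℚ_Σ/ℚ_∞, E[2^∞])` by AEC X.4.4 = `GreenbergVatsalSelmerLink.localKerOver_le_unramKer`);
* DISPLAYED (the honest residue): (b₁) a finitely generated Pontryagin-dual datum `Y` of
  `H¹(ℚ_Σ/ℚ_∞, E[2^∞])` with `Module.rank Λ Y = 1` — weak Leopoldt for `E[2^∞]` over `ℚ_∞`, Kato
  Astérisque 295 Thm. 12.4 read through Greenberg Prop. 4.12's first sentence (PRINT, not yet typed for this
  group); (b₂) `Y[T]` finite — Greenberg p. 119's corank count from `Sel_E(ℚ)_2` finite (PRINT p. 119,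
  kernel-able); (LOC) the single-place local lifts at the finite `w ∈ Σ₀ ∪ {2}` with the `♭`-clause at `2`
  (hypothesis `hloc` of part 7; kernel-able: `cd₂ Γ_η = 1` + Greenberg Prop. 2.1 + `(L♭)_Γ = 0`).
HONEST TAG of COUNT♭@2 after this file: PRINT-by-name {Prop. 4.13 = Cassels, Prop. 4.12} + THEOREM + displayed
{(b₁) rank 1 [PRINT Kato 12.4], (b₂) `Y[T]` finite [PRINT p. 119, kernel-able], LOC/LOC♭ [kernel-able]}.
Nothing about any curve is asserted; no census cell moves; BSD is not proved by any of this.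

References: [GreenbergLNM1716] §2 Prop. 2.1, §3 p. 88, §4 p. 104, Lemma 4.7 pp. 107–108, Prop. 4.12/4.13,
pp. 119, 122; [Kato2004Asterisque] Thm. 12.4; [Sprung2024] §5.2 Lemma 5.5; [Cassels1964ArithmeticVII].
-/

set_option autoImplicit false
-- the Theorems namespace of this sub repeats the summit name by design (D-0017 nested layout)
set_option linter.dupNamespace false

noncomputable section

open scoped Classical NumberField

open NumberField IsDedekindDomain

namespace Summit.BirchSwinnertonDyer.BirchSwinnertonDyer.Theorems.SSFlatEC

open Literature.NumberTheory.EllipticCurves Literature.NumberTheory.GaloisRepresentations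
  WeierstrassCurve ZpExtension Literature.NumberTheory.EllipticCurves.Kobayashi2003
  Literature.NumberTheory.EllipticCurves.Sprung2017 Literature.NumberTheory.EllipticCurves.Sprung2012
  Literature.NumberTheory.EllipticCurves.Sprung2024 Literature.NumberTheory.EllipticCurves.IwasawaDual
  Literature.NumberTheory.EllipticCurves.IwasawaAlgebra Literature.NumberTheory.EllipticCurves.GreenbergVatsal2000
  Literature.NumberTheory.EllipticCurves.Rank1Residual Summit.BirchSwinnertonDyer.Rank1Residual.X5.O1
  Summit.BirchSwinnertonDyer.Rank1Residual.X2

/-- **`Sel^•(E/K_∞) ⊆ H¹(K_Σ/K_∞, E[p^∞])`** for `Σ₀ ⊇` the bad places prime to `p`: the classical Kummer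
condition at a good `v ∤ p` is unramified (Silverman AEC X.4.4 = tree
`GreenbergVatsalSelmerLink.localKerOver_le_unramKer`, imposed at every conjugate).
[cite: SilvermanAEC2009, Cor. X.4.4] [cite: GreenbergVatsal2000, §2 pp. 16–17] -/
theorem sharpFlatSelmerInfty_le_unramifiedOutside {K : Type} [Field K] [NumberField K]
    (W : WeierstrassCurve K) [W.IsElliptic] {p : ℕ} [Fact p.Prime] (κ : ZpExtension K p)
    {E : Type} [Field E] [Algebra K E] (ι : AlgebraicClosure K →ₐ[K] AlgebraicClosure E) (ap : ℤ)
    (g : Field.absoluteGaloisGroup E) (c : ℕ → localPoints W E) (col : Chroma)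
    (S₀ : Set (HeightOneSpectrum (𝓞 K)))
    (hgood : ∀ v : HeightOneSpectrum (𝓞 K), v ∉ S₀ → ((p : ℕ) : 𝓞 K) ∉ v.asIdeal → W.HasGoodReductionAt v) :
    sharpFlatSelmerInfty W κ ι ap g c col ≤ unramifiedOutside κ.kerSubgroup (W.geomPrimaryTorsion p) p S₀ := by
  intro s hs
  rw [mem_unramifiedOutside_iff]
  intro v hv hpv σ
  have h := ((W.mem_selmerGroupOver_iff p κ.kerSubgroup _).mp
    (sharpFlatSelmerInfty_le_selmerInfty W κ ι ap g c col hs)).1 v σ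
  exact GreenbergVatsalSelmerLink.localKerOver_le_unramKer (W := W) (p := p) (H := κ.kerSubgroup)
    (hgood v hv hpv) hpv h

/-- **THE DOOR: COUNT♭@2 from Greenberg's Prop. 4.13 (Cassels) and Prop. 4.12 BY NAME, plus kernel, modulo
the finite local lifts and the two `Λ`-inputs of Prop. 4.12.** `W/ℚ` elliptic, globally minimal, good
supersingular at `2`; `κ` cyclotomic with topological generator `γ`; `v ∋ 2` with `♭`-data `(g, c)` such
that «`Ker Col♭` kills `E(ℚ₂)`» (`h𝒦`) and «`r₂` injective» (`hrp`); `Σ₀` a finite set of places with good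
reduction off `Σ₀ ∪ {2}`. Assume the Literature facts `casselsSurjectivity_H1Sigma ℚ` (Prop. 4.13) and
`prop412_noFiniteSubmodule_H1Sigma_of_rank_one` (Prop. 4.12); a finitely generated dual datum `(Y, dY)` of
`H = H¹(ℚ_Σ/ℚ_∞, E[2^∞])` with (b₁) `Λ`-rank `1` and (b₂) `Y[T]` finite; and (LOC) for every `t ∈ H`
which is `Γ_ℚ`-invariant modulo `Sel♭`, at each finite `w ∈ Σ₀ ∪ {2}` a `2`-power-torsion local class
`x_w ∈ H¹(Γ_{ℚ_w}, E(ℚ̄_w))` with «`loc_w y = x_w` ⇒ `t − res y` classically Kummer above `w` (and ♭ at `2`)».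
Then the COUNT♭@2 clause of `stub_allFlatData` / `stub_pmFlatDataV9` holds verbatim:
`Sel_{2^∞}(E/ℚ)` finite ⇒ `(Sel♭_∞)_γ` finite ⇒ `#ker g♭ · #E(ℚ)[2^∞] = 2^{ord₂ ∏ c_ℓ} · #(Sel♭_∞)_γ` — indeed
`#ker g♭ = 2^{ord₂ ∏ c_ℓ}` (part 8b), `#E(ℚ)[2^∞] = 1`, `(Sel♭_∞)_γ = 0` (parts 4, 7).
[cite: GreenbergLNM1716, §4 Prop. 4.13 / p. 122, Prop. 4.12, p. 104, Lemma 4.7 (pp. 107–108), p. 119]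
[cite: Sprung2024, §5.2 Lemma 5.5 (p. 40)] -/
theorem flatCountTwo_of_print (W : WeierstrassCurve ℚ) [W.IsElliptic] [W.IsGloballyMinimal]
    (hss : GoodSS W 2) (κ : ZpExtension ℚ 2) (hκ : κ.IsCyclotomic) {γ : Field.absoluteGaloisGroup ℚ}
    (hγ : κ.IsTopGenerator γ) {v : HeightOneSpectrum (𝓞 ℚ)} (hv : (2 : 𝓞 ℚ) ∈ v.asIdeal)
    (g : Field.absoluteGaloisGroup (v.adicCompletion ℚ)) (c : ℕ → localPoints W (v.adicCompletion ℚ))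
    -- the two `♭`-clauses in the K3 shapes
    (h𝒦 : ∀ z ∈ colemanKer κ (closureEmb (K := ℚ) (v.adicCompletion ℚ)) W (W.frobeniusTrace 2) g c .flat,
      ∀ (x : localPoints W (v.adicCompletion ℚ))
        (hx : x ∈ localLayerPointsOfEmb κ (closureEmb (K := ℚ) (v.adicCompletion ℚ)) W 0),
        z ⟨x, localLayerPointsOfEmb_le_localTowerPointsOfEmb κ _ W 0 hx⟩ = 0)
    (hrp : ∀ y : W.subgroupH1 2 (κ.layerSubgroup 0),
      W.layerToInfty κ 0 y ∈ sharpFlatLocalKummerOverOfEmb W 2 κ.kerSubgroup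
          (closureEmb (K := ℚ) (v.adicCompletion ℚ))
          (localTowerPointsOfEmb κ (closureEmb (K := ℚ) (v.adicCompletion ℚ)) W)
          (colemanKer κ (closureEmb (K := ℚ) (v.adicCompletion ℚ)) W (W.frobeniusTrace 2) g c .flat) →
        y ∈ W.localKerOver 2 (κ.layerSubgroup 0) (v.adicCompletion ℚ))
    -- `Σ₀`
    (S₀ : Finset (HeightOneSpectrum (𝓞 ℚ)))
    (hgood : ∀ w : HeightOneSpectrum (𝓞 ℚ), w ∉ S₀ → ((2 : ℕ) : 𝓞 ℚ) ∉ w.asIdeal → W.HasGoodReductionAt w)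
    -- PRINT by name
    (hC : Greenberg1999.casselsSurjectivity_H1Sigma ℚ)
    (h412 : Greenberg1999.prop412_noFiniteSubmodule_H1Sigma_of_rank_one)
    -- (b₁), (b₂): the `Λ`-inputs of Prop. 4.12 and p. 119 on a finitely generated dual datum of `H`
    {Y : Type} [AddCommGroup Y] [Module (IwasawaAlgebra 2) Y] [Module.Finite (IwasawaAlgebra 2) Y]
    (dY : Y →+ (unramifiedOutside κ.kerSubgroup (W.geomPrimaryTorsion 2) 2
      (↑S₀ : Set (HeightOneSpectrum (𝓞 ℚ))) →+ AddCircle (1 : ℚ)))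
    (hbij : Function.Bijective dY)
    (hT : ∀ (y : Y) (x : unramifiedOutside κ.kerSubgroup (W.geomPrimaryTorsion 2) 2
        (↑S₀ : Set (HeightOneSpectrum (𝓞 ℚ)))),
      dY ((PowerSeries.X : IwasawaAlgebra 2) • y) x =
        dY y ⟨W.conjH1 2 κ.kerSubgroup γ x,
          conjH1_mem_unramifiedOutside κ.kerSubgroup (W.geomPrimaryTorsion 2) 2 _ γ x.2⟩ - dY y x)
    (hCY : ∀ (a : ℤ_[2]) (y : Y) (x : unramifiedOutside κ.kerSubgroup (W.geomPrimaryTorsion 2) 2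
        (↑S₀ : Set (HeightOneSpectrum (𝓞 ℚ)))) (k : ℕ), (2 ^ k) • x = 0 →
      dY (PowerSeries.C a • y) x = (PadicInt.toZModPow k a).val • dY y x)
    (hrank : Module.rank (IwasawaAlgebra 2) Y = 1)
    (hfin : Finite (invariants 2 Y))
    -- (LOC): the local lifts at the finite places of `Σ`
    (hloc : ∀ t ∈ unramifiedOutside κ.kerSubgroup (W.geomPrimaryTorsion 2) 2
        (↑S₀ : Set (HeightOneSpectrum (𝓞 ℚ))),
      (∀ σ : Field.absoluteGaloisGroup ℚ, W.conjH1 2 κ.kerSubgroup σ t - t ∈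
        sharpFlatSelmerInfty W κ (closureEmb (K := ℚ) (v.adicCompletion ℚ)) (W.frobeniusTrace 2) g c .flat) →
      ∀ w : HeightOneSpectrum (𝓞 ℚ), (w ∈ (↑S₀ : Set (HeightOneSpectrum (𝓞 ℚ))) ∨ ((2 : ℕ) : 𝓞 ℚ) ∈ w.asIdeal) →
      ∃ xw : discreteH1 (localSubgroup (⊤ : Subgroup (Field.absoluteGaloisGroup ℚ)) (w.adicCompletion ℚ))
          (localPoints W (w.adicCompletion ℚ)),
        (∃ k : ℕ, 2 ^ k • xw = 0) ∧
        ∀ y : W.subgroupH1 2 (⊤ : Subgroup (Field.absoluteGaloisGroup ℚ)),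
          W.localResOver 2 ⊤ (w.adicCompletion ℚ) y = xw →
          t - W.resOfLe 2 (le_top : κ.kerSubgroup ≤ ⊤) y ∈
              W.localKerOver 2 κ.kerSubgroup (w.adicCompletion ℚ) ∧
          (w = v → t - W.resOfLe 2 (le_top : κ.kerSubgroup ≤ ⊤) y ∈
            sharpFlatLocalKummerOverOfEmb W 2 κ.kerSubgroup (closureEmb (K := ℚ) (v.adicCompletion ℚ))
              (localTowerPointsOfEmb κ (closureEmb (K := ℚ) (v.adicCompletion ℚ)) W)
              (colemanKer κ (closureEmb (K := ℚ) (v.adicCompletion ℚ)) W (W.frobeniusTrace 2) g c .flat))) :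
    Finite (W.selmerGroupPInfty 2) →
      Finite (EndCoinvariants (conjSharpFlatSelmerInfty W κ (closureEmb (K := ℚ) (v.adicCompletion ℚ))
        (W.frobeniusTrace 2) g c .flat γ - 1)) →
      Nat.card (↥((sharpFlatSelmerInfty W κ (closureEmb (K := ℚ) (v.adicCompletion ℚ))
            (W.frobeniusTrace 2) g c .flat).comap (W.layerToInfty κ 0)) ⧸
          (W.selmerLayer κ 0).addSubgroupOf
            ((sharpFlatSelmerInfty W κ (closureEmb (K := ℚ) (v.adicCompletion ℚ))
              (W.frobeniusTrace 2) g c .flat).comap (W.layerToInfty κ 0))) *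
        Nat.card (MulAction.fixedPoints (Field.absoluteGaloisGroup ℚ) (W.geomPrimaryTorsion 2)) =
      2 ^ (padicValNat 2 W.tamagawaProduct) *
        Nat.card (EndCoinvariants (conjSharpFlatSelmerInfty W κ
          (closureEmb (K := ℚ) (v.adicCompletion ℚ)) (W.frobeniusTrace 2) g c .flat γ - 1)) := by
  -- `#E(ℚ)[2^∞] = 1` at a good supersingular `2`
  have htors : Nat.card (MulAction.fixedPoints (Field.absoluteGaloisGroup ℚ) (W.geomPrimaryTorsion 2)) = 1 := by
    refine W.natCard_fixedPoints_absoluteGaloisGroup_geomPrimaryTorsion_eq_one (p := 2) fun P hP ↦ ?_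
    have h := (irr_two_iff_forall_two_nsmul W).mp
      (Summit.BirchSwinnertonDyer.Rank1Residual.P2.irr_two_of_goodSS_two W hss) P
    apply h
    convert hP
  -- good reduction at the place `v ∋ 2`
  have hv' : ((2 : ℕ) : 𝓞 ℚ) ∈ v.asIdeal := by exact_mod_cast hv
  have hgoodv : W.HasGoodReductionAt v :=
    (hasGoodReductionAtPrime_primesEquiv_iff_holds W v 2
      (Literature.NumberTheory.GaloisRepresentations.LocalField.primesEquiv_eq_of_natCast_mem 2 v hv')).mp hss.1
  refine flatCountTwo_of_cassels_of_coinv W hss κ γ g c (fun hSel ↦ ?_) (fun hSel _ ↦ ?_)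
  · -- Cassels' count, by name (part 8b)
    exact natCard_flatKerG_eq_pow_of_casselsSurjectivity W κ (W.frobeniusTrace 2) g c .flat hC hκ hv' hgoodv
      h𝒦 hrp hSel htors
  · -- COINV♭: Prop. 4.12 by name + Cassels by name + the local lifts (parts 4, 7)
    have hY : ∀ N : Submodule (IwasawaAlgebra 2) Y, Finite N → N = ⊥ :=
      h412 W 2 κ γ hκ hγ S₀ hgood Y dY hbij hT hCY hrank
    haveI := sharpFlatEndCoinvariants_subsingleton_of_cassels_top W κ (W.frobeniusTrace 2) g c .flat hκ hγ
      (↑S₀ : Set (HeightOneSpectrum (𝓞 ℚ))) (fun w hw hpw ↦ hgood w (fun h ↦ hw (Finset.mem_coe.mpr h)) hpw)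
      hv'
      (sharpFlatSelmerInfty_le_unramifiedOutside W κ (closureEmb (K := ℚ) (v.adicCompletion ℚ))
        (W.frobeniusTrace 2) g c .flat _ (fun w hw hpw ↦ hgood w (fun h ↦ hw (Finset.mem_coe.mpr h)) hpw))
      dY hbij hT hCY hY hfin
      (fun x xi hx hxi ↦ hC W 2 hSel htors (↑S₀) (Finset.finite_toSet S₀)
        (fun w hw hpw ↦ hgood w (fun h ↦ hw (Finset.mem_coe.mpr h)) hpw) x xi hx hxi)
      hloc
    exact Nat.card_unique

/-- **THE DOOR on the line's own clauses.** Same as `flatCountTwo_of_print`, with the two K3-shape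
`♭`-clauses DERIVED from the Honda₂ clauses of `stub_allFlatData` (levels `hc`, `n ≥ 1` trace relation
`hTr`, level-`0` generation ON `c_0`: `hinj`, `hsat`, and the local generator `hg`): «`Ker Col♭` kills
`E(ℚ₂)`» is GEN 10's `apply_layer_zero_eq_zero_of_mem_colemanKer_flat`, «`r₂` injective» is GEN 10's
`mem_localKerOver_of_flat_rat` (with Lemma 2.3 at `2`, `eq_zero_of_mem_localTowerPointsOfEmb_of_two_nsmul`).
So on the line the displayed residue of COUNT♭@2 is EXACTLY {(b₁), (b₂), (LOC)} + PRINT by name.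
[cite: GreenbergLNM1716, §4 Prop. 4.13 / p. 122, Prop. 4.12, p. 104, pp. 107–108, p. 119]
[cite: Sprung2024, §5.2 Lemma 5.5 (p. 40)] [cite: Sprung2012, Thm. 2.2, Lemma 2.3, Prop. 7.3] -/
theorem flatCountTwo_of_print_of_clauses (W : WeierstrassCurve ℚ) [W.IsElliptic] [W.IsGloballyMinimal]
    (hss : GoodSS W 2) (κ : ZpExtension ℚ 2) (hκ : κ.IsCyclotomic) {γ : Field.absoluteGaloisGroup ℚ}
    (hγ : κ.IsTopGenerator γ) {v : HeightOneSpectrum (𝓞 ℚ)} (hv : (2 : 𝓞 ℚ) ∈ v.asIdeal)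
    {g : Field.absoluteGaloisGroup (v.adicCompletion ℚ)} {c : ℕ → localPoints W (v.adicCompletion ℚ)}
    -- the Honda₂ clauses of the line
    (hg : κ.IsTopGenerator (resGalOfEmb (closureEmb (K := ℚ) (v.adicCompletion ℚ)) g))
    (hc : ∀ n, c n ∈ localLayerPointsOfEmb κ (closureEmb (K := ℚ) (v.adicCompletion ℚ)) W n)
    (hTr : ∀ n, 1 ≤ n → localTraceOfEmb κ (closureEmb (K := ℚ) (v.adicCompletion ℚ)) W n (n + 1)
      (c (n + 1)) = W.frobeniusTrace 2 • c n - c (n - 1))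
    (hinj : ∀ z₀ : localLayerPointsOfEmb κ (closureEmb (K := ℚ) (v.adicCompletion ℚ)) W 0 →+ ℤ_[2],
      evalOn W (localLayerPointsOfEmb κ (closureEmb (K := ℚ) (v.adicCompletion ℚ)) W 0) z₀ (c 0) = 0 →
        z₀ = 0)
    (hsat : ∀ a : ℤ_[2],
      (∃ z₀ : localLayerPointsOfEmb κ (closureEmb (K := ℚ) (v.adicCompletion ℚ)) W 0 →+ ℤ_[2],
        evalOn W (localLayerPointsOfEmb κ (closureEmb (K := ℚ) (v.adicCompletion ℚ)) W 0) z₀ (c 0) =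
          2 * a) →
      ∃ y : localLayerPointsOfEmb κ (closureEmb (K := ℚ) (v.adicCompletion ℚ)) W 0 →+ ℤ_[2],
        evalOn W (localLayerPointsOfEmb κ (closureEmb (K := ℚ) (v.adicCompletion ℚ)) W 0) y (c 0) = a)
    -- `Σ₀`
    (S₀ : Finset (HeightOneSpectrum (𝓞 ℚ)))
    (hgood : ∀ w : HeightOneSpectrum (𝓞 ℚ), w ∉ S₀ → ((2 : ℕ) : 𝓞 ℚ) ∉ w.asIdeal → W.HasGoodReductionAt w)
    -- PRINT by name
    (hC : Greenberg1999.casselsSurjectivity_H1Sigma ℚ)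
    (h412 : Greenberg1999.prop412_noFiniteSubmodule_H1Sigma_of_rank_one)
    -- (b₁), (b₂)
    {Y : Type} [AddCommGroup Y] [Module (IwasawaAlgebra 2) Y] [Module.Finite (IwasawaAlgebra 2) Y]
    (dY : Y →+ (unramifiedOutside κ.kerSubgroup (W.geomPrimaryTorsion 2) 2
      (↑S₀ : Set (HeightOneSpectrum (𝓞 ℚ))) →+ AddCircle (1 : ℚ)))
    (hbij : Function.Bijective dY)
    (hT : ∀ (y : Y) (x : unramifiedOutside κ.kerSubgroup (W.geomPrimaryTorsion 2) 2
        (↑S₀ : Set (HeightOneSpectrum (𝓞 ℚ)))),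
      dY ((PowerSeries.X : IwasawaAlgebra 2) • y) x =
        dY y ⟨W.conjH1 2 κ.kerSubgroup γ x,
          conjH1_mem_unramifiedOutside κ.kerSubgroup (W.geomPrimaryTorsion 2) 2 _ γ x.2⟩ - dY y x)
    (hCY : ∀ (a : ℤ_[2]) (y : Y) (x : unramifiedOutside κ.kerSubgroup (W.geomPrimaryTorsion 2) 2
        (↑S₀ : Set (HeightOneSpectrum (𝓞 ℚ)))) (k : ℕ), (2 ^ k) • x = 0 →
      dY (PowerSeries.C a • y) x = (PadicInt.toZModPow k a).val • dY y x)
    (hrank : Module.rank (IwasawaAlgebra 2) Y = 1)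
    (hfin : Finite (invariants 2 Y))
    -- (LOC)
    (hloc : ∀ t ∈ unramifiedOutside κ.kerSubgroup (W.geomPrimaryTorsion 2) 2
        (↑S₀ : Set (HeightOneSpectrum (𝓞 ℚ))),
      (∀ σ : Field.absoluteGaloisGroup ℚ, W.conjH1 2 κ.kerSubgroup σ t - t ∈
        sharpFlatSelmerInfty W κ (closureEmb (K := ℚ) (v.adicCompletion ℚ)) (W.frobeniusTrace 2) g c .flat) →
      ∀ w : HeightOneSpectrum (𝓞 ℚ), (w ∈ (↑S₀ : Set (HeightOneSpectrum (𝓞 ℚ))) ∨ ((2 : ℕ) : 𝓞 ℚ) ∈ w.asIdeal) →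
      ∃ xw : discreteH1 (localSubgroup (⊤ : Subgroup (Field.absoluteGaloisGroup ℚ)) (w.adicCompletion ℚ))
          (localPoints W (w.adicCompletion ℚ)),
        (∃ k : ℕ, 2 ^ k • xw = 0) ∧
        ∀ y : W.subgroupH1 2 (⊤ : Subgroup (Field.absoluteGaloisGroup ℚ)),
          W.localResOver 2 ⊤ (w.adicCompletion ℚ) y = xw →
          t - W.resOfLe 2 (le_top : κ.kerSubgroup ≤ ⊤) y ∈
              W.localKerOver 2 κ.kerSubgroup (w.adicCompletion ℚ) ∧
          (w = v → t - W.resOfLe 2 (le_top : κ.kerSubgroup ≤ ⊤) y ∈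
            sharpFlatLocalKummerOverOfEmb W 2 κ.kerSubgroup (closureEmb (K := ℚ) (v.adicCompletion ℚ))
              (localTowerPointsOfEmb κ (closureEmb (K := ℚ) (v.adicCompletion ℚ)) W)
              (colemanKer κ (closureEmb (K := ℚ) (v.adicCompletion ℚ)) W (W.frobeniusTrace 2) g c .flat))) :
    Finite (W.selmerGroupPInfty 2) →
      Finite (EndCoinvariants (conjSharpFlatSelmerInfty W κ (closureEmb (K := ℚ) (v.adicCompletion ℚ))
        (W.frobeniusTrace 2) g c .flat γ - 1)) →
      Nat.card (↥((sharpFlatSelmerInfty W κ (closureEmb (K := ℚ) (v.adicCompletion ℚ))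
            (W.frobeniusTrace 2) g c .flat).comap (W.layerToInfty κ 0)) ⧸
          (W.selmerLayer κ 0).addSubgroupOf
            ((sharpFlatSelmerInfty W κ (closureEmb (K := ℚ) (v.adicCompletion ℚ))
              (W.frobeniusTrace 2) g c .flat).comap (W.layerToInfty κ 0))) *
        Nat.card (MulAction.fixedPoints (Field.absoluteGaloisGroup ℚ) (W.geomPrimaryTorsion 2)) =
      2 ^ (padicValNat 2 W.tamagawaProduct) *
        Nat.card (EndCoinvariants (conjSharpFlatSelmerInfty W κ
          (closureEmb (K := ℚ) (v.adicCompletion ℚ)) (W.frobeniusTrace 2) g c .flat γ - 1)) := by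
  -- Lemma 2.3 at `2` (tree theorem, GEN 10)
  have hnt : ∀ P ∈ localTowerPointsOfEmb κ (closureEmb (K := ℚ) (v.adicCompletion ℚ)) W, 2 • P = 0 → P = 0 :=
    fun P hP h2 ↦ eq_zero_of_mem_localTowerPointsOfEmb_of_two_nsmul W hss κ hv _ hP h2
  refine flatCountTwo_of_print W hss κ hκ hγ hv g c (fun z hz x hx ↦ ?_) (fun y hy ↦ ?_) S₀ hgood hC h412
    dY hbij hT hCY hrank hfin hloc
  · exact apply_layer_zero_eq_zero_of_mem_colemanKer_flat (hc 0) hinj hz hx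
  · exact mem_localKerOver_of_flat_rat W 2 κ hv hnt hss.2 hg hc hTr hinj hsat y hy

/-- **THE DOOR with (b₂) as Greenberg's corank count.** Same as `flatCountTwo_of_print_of_clauses` with
«`Y[T]` finite» replaced by «`rank_{ℤ₂} Y/TY ≤ 1`» (`coinvariantsRank 2 Y ≤ 1`; by Pontryagin duality
`Y/TY ≅ Hom(H^Γ, ℚ/ℤ)`, so this is «`corank_{ℤ₂} H¹(ℚ_Σ/ℚ_∞, E[2^∞])^Γ ≤ 1`», Greenberg p. 119:
«`corank_{ℤ_p} H¹(F_Σ/F, E[p^∞]) = [F:ℚ] + corank_{ℤ_p}(Q_Γ)` … `H¹(F_Σ/F, E[p^∞])` has `ℤ_p`-corank `[F:ℚ]`»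
through the control map `H¹(ℚ_Σ/ℚ, E[2^∞]) ↠ H^Γ`), via the `Λ`-lemma
`IwasawaAlgebra.finite_invariants_of_rank_eq_one_of_coinvariantsRank_le_one` (part 10).
[cite: GreenbergLNM1716, §4 p. 119, Prop. 4.12, Prop. 4.13 / p. 122] -/
theorem flatCountTwo_of_print_of_coinvariantsRank (W : WeierstrassCurve ℚ) [W.IsElliptic] [W.IsGloballyMinimal]
    (hss : GoodSS W 2) (κ : ZpExtension ℚ 2) (hκ : κ.IsCyclotomic) {γ : Field.absoluteGaloisGroup ℚ}
    (hγ : κ.IsTopGenerator γ) {v : HeightOneSpectrum (𝓞 ℚ)} (hv : (2 : 𝓞 ℚ) ∈ v.asIdeal)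
    {g : Field.absoluteGaloisGroup (v.adicCompletion ℚ)} {c : ℕ → localPoints W (v.adicCompletion ℚ)}
    (hg : κ.IsTopGenerator (resGalOfEmb (closureEmb (K := ℚ) (v.adicCompletion ℚ)) g))
    (hc : ∀ n, c n ∈ localLayerPointsOfEmb κ (closureEmb (K := ℚ) (v.adicCompletion ℚ)) W n)
    (hTr : ∀ n, 1 ≤ n → localTraceOfEmb κ (closureEmb (K := ℚ) (v.adicCompletion ℚ)) W n (n + 1)
      (c (n + 1)) = W.frobeniusTrace 2 • c n - c (n - 1))
    (hinj : ∀ z₀ : localLayerPointsOfEmb κ (closureEmb (K := ℚ) (v.adicCompletion ℚ)) W 0 →+ ℤ_[2],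
      evalOn W (localLayerPointsOfEmb κ (closureEmb (K := ℚ) (v.adicCompletion ℚ)) W 0) z₀ (c 0) = 0 →
        z₀ = 0)
    (hsat : ∀ a : ℤ_[2],
      (∃ z₀ : localLayerPointsOfEmb κ (closureEmb (K := ℚ) (v.adicCompletion ℚ)) W 0 →+ ℤ_[2],
        evalOn W (localLayerPointsOfEmb κ (closureEmb (K := ℚ) (v.adicCompletion ℚ)) W 0) z₀ (c 0) =
          2 * a) →
      ∃ y : localLayerPointsOfEmb κ (closureEmb (K := ℚ) (v.adicCompletion ℚ)) W 0 →+ ℤ_[2],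
        evalOn W (localLayerPointsOfEmb κ (closureEmb (K := ℚ) (v.adicCompletion ℚ)) W 0) y (c 0) = a)
    (S₀ : Finset (HeightOneSpectrum (𝓞 ℚ)))
    (hgood : ∀ w : HeightOneSpectrum (𝓞 ℚ), w ∉ S₀ → ((2 : ℕ) : 𝓞 ℚ) ∉ w.asIdeal → W.HasGoodReductionAt w)
    (hC : Greenberg1999.casselsSurjectivity_H1Sigma ℚ)
    (h412 : Greenberg1999.prop412_noFiniteSubmodule_H1Sigma_of_rank_one)
    {Y : Type} [AddCommGroup Y] [Module (IwasawaAlgebra 2) Y] [Module.Finite (IwasawaAlgebra 2) Y]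
    (dY : Y →+ (unramifiedOutside κ.kerSubgroup (W.geomPrimaryTorsion 2) 2
      (↑S₀ : Set (HeightOneSpectrum (𝓞 ℚ))) →+ AddCircle (1 : ℚ)))
    (hbij : Function.Bijective dY)
    (hT : ∀ (y : Y) (x : unramifiedOutside κ.kerSubgroup (W.geomPrimaryTorsion 2) 2
        (↑S₀ : Set (HeightOneSpectrum (𝓞 ℚ)))),
      dY ((PowerSeries.X : IwasawaAlgebra 2) • y) x =
        dY y ⟨W.conjH1 2 κ.kerSubgroup γ x,
          conjH1_mem_unramifiedOutside κ.kerSubgroup (W.geomPrimaryTorsion 2) 2 _ γ x.2⟩ - dY y x)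
    (hCY : ∀ (a : ℤ_[2]) (y : Y) (x : unramifiedOutside κ.kerSubgroup (W.geomPrimaryTorsion 2) 2
        (↑S₀ : Set (HeightOneSpectrum (𝓞 ℚ)))) (k : ℕ), (2 ^ k) • x = 0 →
      dY (PowerSeries.C a • y) x = (PadicInt.toZModPow k a).val • dY y x)
    -- (b₁) and (b₂)' : `rank_Λ Y = 1`, `rank_{ℤ₂} Y/TY ≤ 1`
    (hrank : Module.rank (IwasawaAlgebra 2) Y = 1) (hco : coinvariantsRank 2 Y ≤ 1)
    (hloc : ∀ t ∈ unramifiedOutside κ.kerSubgroup (W.geomPrimaryTorsion 2) 2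
        (↑S₀ : Set (HeightOneSpectrum (𝓞 ℚ))),
      (∀ σ : Field.absoluteGaloisGroup ℚ, W.conjH1 2 κ.kerSubgroup σ t - t ∈
        sharpFlatSelmerInfty W κ (closureEmb (K := ℚ) (v.adicCompletion ℚ)) (W.frobeniusTrace 2) g c .flat) →
      ∀ w : HeightOneSpectrum (𝓞 ℚ), (w ∈ (↑S₀ : Set (HeightOneSpectrum (𝓞 ℚ))) ∨ ((2 : ℕ) : 𝓞 ℚ) ∈ w.asIdeal) →
      ∃ xw : discreteH1 (localSubgroup (⊤ : Subgroup (Field.absoluteGaloisGroup ℚ)) (w.adicCompletion ℚ))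
          (localPoints W (w.adicCompletion ℚ)),
        (∃ k : ℕ, 2 ^ k • xw = 0) ∧
        ∀ y : W.subgroupH1 2 (⊤ : Subgroup (Field.absoluteGaloisGroup ℚ)),
          W.localResOver 2 ⊤ (w.adicCompletion ℚ) y = xw →
          t - W.resOfLe 2 (le_top : κ.kerSubgroup ≤ ⊤) y ∈
              W.localKerOver 2 κ.kerSubgroup (w.adicCompletion ℚ) ∧
          (w = v → t - W.resOfLe 2 (le_top : κ.kerSubgroup ≤ ⊤) y ∈
            sharpFlatLocalKummerOverOfEmb W 2 κ.kerSubgroup (closureEmb (K := ℚ) (v.adicCompletion ℚ))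
              (localTowerPointsOfEmb κ (closureEmb (K := ℚ) (v.adicCompletion ℚ)) W)
              (colemanKer κ (closureEmb (K := ℚ) (v.adicCompletion ℚ)) W (W.frobeniusTrace 2) g c .flat))) :
    Finite (W.selmerGroupPInfty 2) →
      Finite (EndCoinvariants (conjSharpFlatSelmerInfty W κ (closureEmb (K := ℚ) (v.adicCompletion ℚ))
        (W.frobeniusTrace 2) g c .flat γ - 1)) →
      Nat.card (↥((sharpFlatSelmerInfty W κ (closureEmb (K := ℚ) (v.adicCompletion ℚ))
            (W.frobeniusTrace 2) g c .flat).comap (W.layerToInfty κ 0)) ⧸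
          (W.selmerLayer κ 0).addSubgroupOf
            ((sharpFlatSelmerInfty W κ (closureEmb (K := ℚ) (v.adicCompletion ℚ))
              (W.frobeniusTrace 2) g c .flat).comap (W.layerToInfty κ 0))) *
        Nat.card (MulAction.fixedPoints (Field.absoluteGaloisGroup ℚ) (W.geomPrimaryTorsion 2)) =
      2 ^ (padicValNat 2 W.tamagawaProduct) *
        Nat.card (EndCoinvariants (conjSharpFlatSelmerInfty W κ
          (closureEmb (K := ℚ) (v.adicCompletion ℚ)) (W.frobeniusTrace 2) g c .flat γ - 1)) :=
  flatCountTwo_of_print_of_clauses W hss κ hκ hγ hv hg hc hTr hinj hsat S₀ hgood hC h412 dY hbij hT hCY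
    hrank (IwasawaAlgebra.finite_invariants_of_rank_eq_one_of_coinvariantsRank_le_one 2 hrank hco) hloc

end Summit.BirchSwinnertonDyer.BirchSwinnertonDyer.Theorems.SSFlatEC

end
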